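import Summits.KontsevichZagierPeriods.KontsevichZagierPeriods.Theses.GenericPointClass
import Summits.KontsevichZagierPeriods.KontsevichZagierPeriods.Theorems.GaussManinCertificatesKZStokesBox
import Literature.NumberTheory.Transcendental.KZLogCalculusProofs
import Literature.NumberTheory.Transcendental.KZGroundingRelations

/-!
# Crux `ExactDescentBox` (stmt-KontsevichZagierPeriods-4427) — strategist line `relabel_nl`

Route `GenericPointClass`, crux #4 (the ENGINE, "Theorem B on boxes").

## The line (TRANSFER of the PROVED sibling `CubeStokes`, stmt-5566, to boxes)

The sibling crux `CobordismMove.CubeStokes` was proved (Cruxes/CubeStokes/CubeStokesProof.lean,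
rc 0, 0 sorry) through the cut `CubeCoordinateCycle` (relabelling the coordinates of a BARE
representation is ONE rule-(2) move) + `CubeLastNewtonLeibniz` (Newton–Leibniz along the LAST
coordinate, bulk term included) + a sorry-free assembly transporting the potentials through the
relabelling. This line is that cut, verbatim, on a general open box `∏ (aᵢ, bᵢ)`:

* `stub_boxRelabel : BoxRelabel` — for a permutation `e` of the coordinates, the representation
  `[∏ (a_{e⁻¹ i}, b_{e⁻¹ i}), f (z ∘ e)]` differs from `[∏ (aᵢ, bᵢ), f]` by ONE change of variables
  (linear relabelling map, `ℚ`-polynomial, `|det| = 1` by volume preservation of the box of finite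
  positive volume). ARBITRARY integrand, NO potentials: template `cubeCoordinateCycle_proof` (§2 of
  the sibling file, 60 lines; the only change is `volume box = ∏ (bᵢ − aᵢ)` in place of `1`).
* `stub_boxLastNewtonLeibniz : BoxLastNewtonLeibniz` — on the open box, an integrand which is
  `∂A/∂z_last` (fibrewise `HasDerivAt` along `Fin.snoc`) for a potential `A` semialgebraic and
  continuous on the closed box descends to ONE face representation
  `[open base box, A(·, b_last) − A(·, a_last)]`: rule (1a) to the closed-fibre band (two null faces,
  integrand extended by `0`), ONE rule-(3) move with primitive `A` and the constant (algebraic)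
  sections `a_last ≤ b_last`. Template `cubeLastNewtonLeibniz_proof` (§3, 150 lines) and the PROVED
  `GaussManinCertificates.KZStokesBox_proof` (same band, zero boundary values); corners are algebraic
  by `isAlgebraic_corner_of_isSemialgebraic_openBox`.

The kernel-checked assembly `ExactDescentBox_of : BoxRelabel → BoxLastNewtonLeibniz → ExactDescentBox`
carries ALL the potential-transport bookkeeping (semialgebraicity by `IsSemialgebraicFunOn.comp_equiv`,
continuity, integrability by `volume_measurePreserving_piCongrLeft`, the fibrewise derivative via
`update ∘ insertNth`, the identification of the face representation) and the finite-sum bookkeeping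
(`KZ.of_sub_sum_integrand_mem_relations`). Sorries live ONLY in the two `stub_*` theorems.

Why it dodges the hardest stub of line `birth` (`stub_transportToLast :
LastCoordinateDescent → SingleCoordinateDescent`, transport of the whole descent statement with its
potential hypotheses): here the rule-(2) stub moves a BARE representation (no hypotheses to carry),
exactly the shape already proved on the cube; the hypotheses are moved once and for all in the
sorry-free glue below.

Disproof used: none on file for this crux (`ledger crux ls`: no `Disproof.lean`); the negatives
index of the summit has no statement about boxes / divergences / relabellings.
-/

noncomputable section

open MeasureTheory Set
open Literature.NumberTheory.Transcendental
open Literature.ModelTheory.ExponentialFields (IsSemialgebraic)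
open Summit.KontsevichZagierPeriods.GaussManinCertificates
  (isAlgebraic_corner_of_isSemialgebraic_openBox isSemialgebraic_openBox_of_isAlgebraic)

namespace Summit.KontsevichZagierPeriods.KontsevichZagierPeriods.Cruxes.ExactDescentBox.RelabelNL

/-! ### The stub statements -/

/-- **Relabelling the coordinates of a box representation is a move.** For a permutation `e` of
`Fin (d + 1)`, a representation `R` on the open box `∏ᵢ (aᵢ, bᵢ)` and a representation `R'` on the
relabelled box `∏ᵢ (a_{e⁻¹ i}, b_{e⁻¹ i})` with `R'.integrand z = R.integrand (z ∘ e)` there,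
`[R] − [R'] ∈ KZ.relations` (one rule-(2) move along the linear relabelling `z ↦ z ∘ e`, which maps
the relabelled box onto the box, `|det| = 1`). Arbitrary integrand. -/
def BoxRelabel : Prop :=
  ∀ (d : ℕ) (e : Equiv.Perm (Fin (d + 1))) (a b : Fin (d + 1) → ℝ) (R R' : KZ.IntegralRep (d + 1)),
    (∀ i, a i < b i) →
    R.domain = {x | ∀ i, x i ∈ Set.Ioo (a i) (b i)} →
    R'.domain = {z | ∀ i, z i ∈ Set.Ioo (a (e.symm i)) (b (e.symm i))} →
    Set.EqOn R'.integrand (fun z => R.integrand (fun i => z (e i))) R'.domain →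
    KZ.of R - KZ.of R' ∈ KZ.relations

/-- **Newton–Leibniz along the last coordinate of an open box, bulk term included.** On the open
box `∏ᵢ (aᵢ, bᵢ) ⊂ ℝᵈ⁺¹`, if `A` is `ℚ`-semialgebraic and continuous on the closed box and
`σ ↦ A (Fin.snoc y σ)` has derivative `A' (Fin.snoc y t)` at every `t ∈ (a_last, b_last)` for every
`y` in the open base box, then `[box, A'] − [open base box, A(·, b_last) − A(·, a_last)] ∈
KZ.relations`. -/
def BoxLastNewtonLeibniz : Prop :=
  ∀ (d : ℕ) (a b : Fin (d + 1) → ℝ) (A A' : (Fin (d + 1) → ℝ) → ℝ) (R : KZ.IntegralRep (d + 1))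
    (s : KZ.IntegralRep d),
    (∀ i, a i < b i) →
    IsSemialgebraicFunOn ℚ {z | ∀ j, z j ∈ Set.Icc (a j) (b j)} A →
    ContinuousOn A {z | ∀ j, z j ∈ Set.Icc (a j) (b j)} →
    (∀ y : Fin d → ℝ, (∀ j, y j ∈ Set.Ioo (a (Fin.castSucc j)) (b (Fin.castSucc j))) →
      ∀ t ∈ Set.Ioo (a (Fin.last d)) (b (Fin.last d)),
        HasDerivAt (fun σ : ℝ => A (Fin.snoc y σ)) (A' (Fin.snoc y t)) t) →
    R.domain = {x | ∀ i, x i ∈ Set.Ioo (a i) (b i)} →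
    Set.EqOn R.integrand A' R.domain →
    s.domain = {y | ∀ j, y j ∈ Set.Ioo (a (Fin.castSucc j)) (b (Fin.castSucc j))} →
    Set.EqOn s.integrand
      (fun y => A (Fin.snoc y (b (Fin.last d))) - A (Fin.snoc y (a (Fin.last d)))) s.domain →
    KZ.of R - KZ.of s ∈ KZ.relations

/-! ### Registered stubs (the ONLY sorries of this file) -/

/-- Stub 1: relabelling the coordinates of a box representation is one rule-(2) move
(template: `CobordismMove.CubeCoordinateCycle.cubeCoordinateCycle_proof`). Size S–M. -/
theorem stub_boxRelabel : BoxRelabel := by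
  sorry

/-- Stub 2: Newton–Leibniz along the last coordinate of an open box with bulk term
(template: `CobordismMove.CubeLastNewtonLeibniz.cubeLastNewtonLeibniz_proof`,
`GaussManinCertificates.KZStokesBox_proof`). Size M (hardest). -/
theorem stub_boxLastNewtonLeibniz : BoxLastNewtonLeibniz := by
  sorry

/-! ### Sorry-free glue: coordinate cycles, transport of the data, assembly -/

variable {d : ℕ}

/-- The coordinate cycle `z ↦ Fin.insertNth k (z last) (Fin.init z)` of `ℝᵈ⁺¹` is the relabelling
along the permutation `e = (finSuccEquiv' k).trans (finSuccEquiv' (Fin.last d)).symm`, which sends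
`k ↦ last` and `k.succAbove j ↦ j.castSucc`. [folklore] -/
theorem exists_perm_insertNth (k : Fin (d + 1)) :
    ∃ e : Equiv.Perm (Fin (d + 1)),
      (∀ z : Fin (d + 1) → ℝ,
        (fun i => z (e i)) = (Fin.insertNth k (z (Fin.last d)) (Fin.init z) : Fin (d + 1) → ℝ)) ∧
      e.symm (Fin.last d) = k ∧ ∀ j : Fin d, e.symm (Fin.castSucc j) = k.succAbove j := by
  refine ⟨(finSuccEquiv' k).trans (finSuccEquiv' (Fin.last d)).symm, fun z => ?_, ?_, fun j => ?_⟩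
  · funext i
    rcases Fin.eq_self_or_eq_succAbove k i with rfl | ⟨j, rfl⟩
    · simp [finSuccEquiv'_at, finSuccEquiv'_symm_none, Fin.insertNth_apply_same]
    · simp [finSuccEquiv'_succAbove, finSuccEquiv'_symm_some, Fin.insertNth_apply_succAbove,
        Fin.succAbove_last, Fin.init]
  · rw [Equiv.symm_apply_eq]
    simp [finSuccEquiv'_at, finSuccEquiv'_symm_none]
  · rw [Equiv.symm_apply_eq]
    simp [finSuccEquiv'_succAbove, finSuccEquiv'_symm_some, Fin.succAbove_last]

/-- Membership of a relabelled point in an open box. [folklore] -/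
theorem comp_perm_mem_openBox_iff (e : Equiv.Perm (Fin (d + 1))) (a b : Fin (d + 1) → ℝ)
    (z : Fin (d + 1) → ℝ) :
    (fun i => z (e i)) ∈ {x : Fin (d + 1) → ℝ | ∀ i, x i ∈ Ioo (a i) (b i)} ↔
      z ∈ {x : Fin (d + 1) → ℝ | ∀ i, x i ∈ Ioo (a (e.symm i)) (b (e.symm i))} := by
  simp only [mem_setOf_eq]
  constructor
  · intro h i
    simpa using h (e.symm i)
  · intro h i
    simpa using h (e i)

/-- Membership of a relabelled point in a closed box. [folklore] -/
theorem comp_perm_mem_closedBox_iff (e : Equiv.Perm (Fin (d + 1))) (a b : Fin (d + 1) → ℝ)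
    (z : Fin (d + 1) → ℝ) :
    (fun i => z (e i)) ∈ {x : Fin (d + 1) → ℝ | ∀ i, x i ∈ Icc (a i) (b i)} ↔
      z ∈ {x : Fin (d + 1) → ℝ | ∀ i, x i ∈ Icc (a (e.symm i)) (b (e.symm i))} := by
  simp only [mem_setOf_eq]
  constructor
  · intro h i
    simpa using h (e.symm i)
  · intro h i
    simpa using h (e i)

/-- An open box is open. [folklore] -/
theorem isOpen_openBox {N : ℕ} (a b : Fin N → ℝ) :
    IsOpen {x : Fin N → ℝ | ∀ i, x i ∈ Ioo (a i) (b i)} := by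
  have h : {x : Fin N → ℝ | ∀ i, x i ∈ Ioo (a i) (b i)} = ⋂ i, (fun x : Fin N → ℝ => x i) ⁻¹' Ioo (a i) (b i) := by
    ext x
    simp
  rw [h]
  exact isOpen_iInter_of_finite fun i => isOpen_Ioo.preimage (continuous_apply i)

/-- Semialgebraicity is invariant under relabelling coordinates (open box). [folklore] -/
theorem isSemialgebraicFunOn_comp_perm_openBox (e : Equiv.Perm (Fin (d + 1))) (a b : Fin (d + 1) → ℝ)
    {f : (Fin (d + 1) → ℝ) → ℝ}
    (hf : IsSemialgebraicFunOn ℚ {x : Fin (d + 1) → ℝ | ∀ i, x i ∈ Ioo (a i) (b i)} f) :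
    IsSemialgebraicFunOn ℚ {x : Fin (d + 1) → ℝ | ∀ i, x i ∈ Ioo (a (e.symm i)) (b (e.symm i))}
      (fun z => f (fun i => z (e i))) := by
  have h := hf.comp_equiv e
  have hset : {w : Fin (d + 1) → ℝ | (fun i => w (e i)) ∈
      {x : Fin (d + 1) → ℝ | ∀ i, x i ∈ Ioo (a i) (b i)}} =
      {x : Fin (d + 1) → ℝ | ∀ i, x i ∈ Ioo (a (e.symm i)) (b (e.symm i))} := by
    ext w
    exact comp_perm_mem_openBox_iff e a b w
  rwa [hset] at h

/-- Semialgebraicity is invariant under relabelling coordinates (closed box). [folklore] -/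
theorem isSemialgebraicFunOn_comp_perm_closedBox (e : Equiv.Perm (Fin (d + 1)))
    (a b : Fin (d + 1) → ℝ) {f : (Fin (d + 1) → ℝ) → ℝ}
    (hf : IsSemialgebraicFunOn ℚ {x : Fin (d + 1) → ℝ | ∀ i, x i ∈ Icc (a i) (b i)} f) :
    IsSemialgebraicFunOn ℚ {x : Fin (d + 1) → ℝ | ∀ i, x i ∈ Icc (a (e.symm i)) (b (e.symm i))}
      (fun z => f (fun i => z (e i))) := by
  have h := hf.comp_equiv e
  have hset : {w : Fin (d + 1) → ℝ | (fun i => w (e i)) ∈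
      {x : Fin (d + 1) → ℝ | ∀ i, x i ∈ Icc (a i) (b i)}} =
      {x : Fin (d + 1) → ℝ | ∀ i, x i ∈ Icc (a (e.symm i)) (b (e.symm i))} := by
    ext w
    exact comp_perm_mem_closedBox_iff e a b w
  rwa [hset] at h

/-- Relabelling coordinates is continuous. [folklore] -/
theorem continuous_comp_perm {N : ℕ} (e : Equiv.Perm (Fin N)) :
    Continuous (fun z : Fin N → ℝ => fun i => z (e i)) :=
  continuous_pi fun i => continuous_apply (e i)

/-- Absolute integrability is invariant under relabelling coordinates (open box): the relabelling
is the volume-preserving `MeasurableEquiv.piCongrLeft`, pulling the box back to the relabelled box.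
[folklore] -/
theorem integrableOn_comp_perm_openBox (e : Equiv.Perm (Fin (d + 1))) (a b : Fin (d + 1) → ℝ)
    {f : (Fin (d + 1) → ℝ) → ℝ}
    (hf : IntegrableOn f {x : Fin (d + 1) → ℝ | ∀ i, x i ∈ Ioo (a i) (b i)}) :
    IntegrableOn (fun z => f (fun i => z (e i)))
      {x : Fin (d + 1) → ℝ | ∀ i, x i ∈ Ioo (a (e.symm i)) (b (e.symm i))} := by
  set L : (Fin (d + 1) → ℝ) ≃ᵐ (Fin (d + 1) → ℝ) :=
    MeasurableEquiv.piCongrLeft (fun _ : Fin (d + 1) => ℝ) e.symm with hL_def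
  have hL : MeasurePreserving L volume volume :=
    volume_measurePreserving_piCongrLeft (fun _ : Fin (d + 1) => ℝ) e.symm
  have hLapply : ∀ z : Fin (d + 1) → ℝ, L z = fun i => z (e i) := by
    intro z
    funext i
    have h := Equiv.piCongrLeft_apply_apply (fun _ : Fin (d + 1) => ℝ) e.symm z (e i)
    rw [hL_def, MeasurableEquiv.coe_piCongrLeft]
    simpa using h
  have hpre : L ⁻¹' {x : Fin (d + 1) → ℝ | ∀ i, x i ∈ Ioo (a i) (b i)} =
      {x : Fin (d + 1) → ℝ | ∀ i, x i ∈ Ioo (a (e.symm i)) (b (e.symm i))} := by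
    ext z
    rw [mem_preimage, hLapply]
    exact comp_perm_mem_openBox_iff e a b z
  have h := (hL.integrableOn_comp_preimage L.measurableEmbedding (f := f)
    (s := {x : Fin (d + 1) → ℝ | ∀ i, x i ∈ Ioo (a i) (b i)})).mpr hf
  rw [hpre] at h
  exact h.congr_fun (fun z _ => by simp only [Function.comp_apply, hLapply])
    (isOpen_openBox _ _).measurableSet

/-- Updating the inserted coordinate. [folklore] -/
theorem update_insertNth (k : Fin (d + 1)) (t s : ℝ) (y : Fin d → ℝ) :
    Function.update (Fin.insertNth k t y : Fin (d + 1) → ℝ) k s = Fin.insertNth k s y := by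
  funext i
  rcases Fin.eq_self_or_eq_succAbove k i with rfl | ⟨j, rfl⟩
  · simp [Fin.insertNth_apply_same]
  · rw [Function.update_of_ne (Fin.succAbove_ne k j)]
    simp [Fin.insertNth_apply_succAbove]

/-- Inserting a coordinate of `(a_k, b_k)` into a point of the open face box gives a point of the
open box. [folklore] -/
theorem insertNth_mem_openBox (k : Fin (d + 1)) (a b : Fin (d + 1) → ℝ) {t : ℝ}
    (ht : t ∈ Ioo (a k) (b k)) {y : Fin d → ℝ}
    (hy : ∀ j, y j ∈ Ioo (a (k.succAbove j)) (b (k.succAbove j))) :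
    (Fin.insertNth k t y : Fin (d + 1) → ℝ) ∈ {x : Fin (d + 1) → ℝ | ∀ i, x i ∈ Ioo (a i) (b i)} := by
  simp only [mem_setOf_eq]
  intro i
  rcases Fin.eq_self_or_eq_succAbove k i with rfl | ⟨j, rfl⟩
  · simpa [Fin.insertNth_apply_same] using ht
  · simpa [Fin.insertNth_apply_succAbove] using hy j

/-- **Descent along one coordinate `k`** from the two stubs: on the open box, an integrand `A'`
which is `∂A/∂z_k` for a potential `A` semialgebraic and continuous on the closed box descends to
the face representation `[open face box, A(z_k = b_k) − A(z_k = a_k)]`. The potential and its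
derivative are transported through the coordinate cycle `z ↦ insertNth k (z last) (init z)`
(relabelling `e`), `BoxRelabel` moves the bulk representation, `BoxLastNewtonLeibniz` descends the
relabelled bulk to the face. -/
theorem singleCoordinateDescent (h₁ : BoxRelabel) (h₂ : BoxLastNewtonLeibniz)
    (n : ℕ) (k : Fin (n + 1)) (a b : Fin (n + 1) → ℝ) (A A' : (Fin (n + 1) → ℝ) → ℝ)
    (R : KZ.IntegralRep (n + 1)) (s : KZ.IntegralRep n)
    (hab : ∀ i, a i < b i)
    (hRd : R.domain = {z | ∀ i, z i ∈ Set.Ioo (a i) (b i)})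
    (hA : IsSemialgebraicFunOn ℚ {z | ∀ j, z j ∈ Set.Icc (a j) (b j)} A)
    (hAc : ContinuousOn A {z | ∀ j, z j ∈ Set.Icc (a j) (b j)})
    (hder : ∀ z ∈ R.domain, HasDerivAt (fun t : ℝ => A (Function.update z k t)) (A' z) (z k))
    (hRi : Set.EqOn R.integrand A' R.domain)
    (hsd : s.domain = {y | ∀ j, y j ∈ Set.Ioo (a (Fin.succAbove k j)) (b (Fin.succAbove k j))})
    (hsi : Set.EqOn s.integrand (fun y => A (Fin.insertNth k (b k) y) - A (Fin.insertNth k (a k) y))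
      s.domain) :
    KZ.of R - KZ.of s ∈ KZ.relations := by
  obtain ⟨e, he, hek, hej⟩ := exists_perm_insertNth (d := n) k
  -- the relabelled corners
  set a' : Fin (n + 1) → ℝ := fun i => a (e.symm i) with ha'
  set b' : Fin (n + 1) → ℝ := fun i => b (e.symm i) with hb'
  have hab' : ∀ i, a' i < b' i := fun i => hab _
  have ha'last : a' (Fin.last n) = a k := by simp [ha', hek]
  have hb'last : b' (Fin.last n) = b k := by simp [hb', hek]
  have ha'cast : ∀ j : Fin n, a' (Fin.castSucc j) = a (k.succAbove j) := fun j => by simp [ha', hej]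
  have hb'cast : ∀ j : Fin n, b' (Fin.castSucc j) = b (k.succAbove j) := fun j => by simp [hb', hej]
  -- the corners are algebraic, so the relabelled open box is semialgebraic
  have halg : ∀ i, IsAlgebraic ℚ (a i) ∧ IsAlgebraic ℚ (b i) :=
    isAlgebraic_corner_of_isSemialgebraic_openBox hab (hRd ▸ R.isSemialgebraic_domain)
  have hbox' : IsSemialgebraic ℚ {x : Fin (n + 1) → ℝ | ∀ i, x i ∈ Ioo (a' i) (b' i)} :=
    isSemialgebraic_openBox_of_isAlgebraic (fun i => (halg _).1) fun i => (halg _).2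
  -- (a) transport of the data through the relabelling
  have hA'sa : IsSemialgebraicFunOn ℚ {x : Fin (n + 1) → ℝ | ∀ i, x i ∈ Ioo (a i) (b i)} A' := by
    have h := R.isSemialgebraicFunOn_integrand.congr hRi
    rwa [hRd] at h
  have hA'int : IntegrableOn A' {x : Fin (n + 1) → ℝ | ∀ i, x i ∈ Ioo (a i) (b i)} := by
    have h := R.integrableOn.congr_fun hRi (KZ.IntegralRep.measurableSet_domain_holds R)
    rwa [hRd] at h
  have hBsa : IsSemialgebraicFunOn ℚ {x : Fin (n + 1) → ℝ | ∀ i, x i ∈ Icc (a' i) (b' i)}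
      (fun z => A (fun i => z (e i))) :=
    isSemialgebraicFunOn_comp_perm_closedBox e a b hA
  have hB'sa : IsSemialgebraicFunOn ℚ {x : Fin (n + 1) → ℝ | ∀ i, x i ∈ Ioo (a' i) (b' i)}
      (fun z => A' (fun i => z (e i))) :=
    isSemialgebraicFunOn_comp_perm_openBox e a b hA'sa
  have hB'int : IntegrableOn (fun z => A' (fun i => z (e i)))
      {x : Fin (n + 1) → ℝ | ∀ i, x i ∈ Ioo (a' i) (b' i)} :=
    integrableOn_comp_perm_openBox e a b hA'int
  have hBcont : ContinuousOn (fun z => A (fun i => z (e i)))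
      {x : Fin (n + 1) → ℝ | ∀ i, x i ∈ Icc (a' i) (b' i)} :=
    hAc.comp (continuous_comp_perm e).continuousOn fun z hz =>
      (comp_perm_mem_closedBox_iff e a b z).2 hz
  have hBder : ∀ y : Fin n → ℝ, (∀ j, y j ∈ Ioo (a' (Fin.castSucc j)) (b' (Fin.castSucc j))) →
      ∀ t ∈ Ioo (a' (Fin.last n)) (b' (Fin.last n)),
        HasDerivAt (fun σ : ℝ => A (fun i => (Fin.snoc y σ : Fin (n + 1) → ℝ) (e i)))
          (A' (fun i => (Fin.snoc y t : Fin (n + 1) → ℝ) (e i))) t := by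
    intro y hy t ht
    have hfun : (fun σ : ℝ => A (fun i => (Fin.snoc y σ : Fin (n + 1) → ℝ) (e i))) =
        fun σ : ℝ => A (Fin.insertNth k σ y) := by
      funext σ
      rw [he]
      simp [Fin.snoc_last, Fin.init_snoc]
    have hval : (fun i => (Fin.snoc y t : Fin (n + 1) → ℝ) (e i)) = Fin.insertNth k t y := by
      rw [he]
      simp [Fin.snoc_last, Fin.init_snoc]
    rw [hfun, hval]
    rw [ha'last, hb'last] at ht
    have hy' : ∀ j, y j ∈ Ioo (a (k.succAbove j)) (b (k.succAbove j)) := fun j => by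
      simpa [ha'cast, hb'cast] using hy j
    have hx : (Fin.insertNth k t y : Fin (n + 1) → ℝ) ∈ R.domain := by
      rw [hRd]
      exact insertNth_mem_openBox k a b ht hy'
    have h := hder _ hx
    simp only [Fin.insertNth_apply_same, update_insertNth] at h
    exact h
  -- (b) the relabelled bulk representation
  let Rt : KZ.IntegralRep (n + 1) :=
    { domain := {x | ∀ i, x i ∈ Ioo (a' i) (b' i)}
      integrand := fun z => A' (fun i => z (e i))
      isSemialgebraic_domain := hbox'
      isSemialgebraicFunOn_integrand := hB'sa
      integrableOn := hB'int }
  -- (c) the two moves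
  have hrel₁ : KZ.of R - KZ.of Rt ∈ KZ.relations :=
    h₁ n e a b R Rt hab hRd rfl fun z hz => by
      show A' (fun i => z (e i)) = R.integrand (fun i => z (e i))
      rw [hRi]
      rw [hRd]
      exact (comp_perm_mem_openBox_iff e a b z).2 hz
  have hrel₂ : KZ.of Rt - KZ.of s ∈ KZ.relations := by
    refine h₂ n a' b' (fun z => A (fun i => z (e i))) (fun z => A' (fun i => z (e i))) Rt s hab'
      hBsa hBcont hBder rfl (fun z _ => rfl) ?_ ?_
    · rw [hsd]
      ext y
      simp only [mem_setOf_eq, ha'cast, hb'cast]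
    · intro y hy
      rw [hsi hy]
      have h1 : (fun i => (Fin.snoc y (b' (Fin.last n)) : Fin (n + 1) → ℝ) (e i)) =
          Fin.insertNth k (b k) y := by
        rw [he]
        simp [Fin.snoc_last, Fin.init_snoc, hb'last]
      have h0 : (fun i => (Fin.snoc y (a' (Fin.last n)) : Fin (n + 1) → ℝ) (e i)) =
          Fin.insertNth k (a k) y := by
        rw [he]
        simp [Fin.snoc_last, Fin.init_snoc, ha'last]
      simp only [h1, h0]
  have heq : KZ.of R - KZ.of s = (KZ.of R - KZ.of Rt) + (KZ.of Rt - KZ.of s) := by abel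
  rw [heq]
  exact KZ.relations.add_mem hrel₁ hrel₂

/-! ### The assembly: the crux BY NAME from the two stub statements -/

/-- **Assembly.** `BoxRelabel → BoxLastNewtonLeibniz → ExactDescentBox`: split `[box, ∑ᵢ ∂ᵢAᵢ]` into
the pieces `[box, ∂ᵢAᵢ]` (iterated rule (1b), `KZ.of_sub_sum_integrand_mem_relations`), descend each
piece along its own coordinate (`singleCoordinateDescent`), and add up in `KZ.relations`. -/
theorem ExactDescentBox_of (h₁ : BoxRelabel) (h₂ : BoxLastNewtonLeibniz) :
    Summit.KontsevichZagierPeriods.KontsevichZagierPeriods.Theses.GenericPointClass.ExactDescentBox := by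
  intro n a b r A A' s hab hdom hA hAc hder hA' hint hsum hsd hsi
  -- the per-coordinate pieces `[box, ∂ᵢ Aᵢ]`
  let R : Fin (n + 1) → KZ.IntegralRep (n + 1) := fun i =>
    { domain := r.domain
      integrand := A' i
      isSemialgebraic_domain := r.isSemialgebraic_domain
      isSemialgebraicFunOn_integrand := hA' i
      integrableOn := hint i }
  have hsplit : KZ.of r - ∑ i, KZ.of (R i) ∈ KZ.relations :=
    KZ.of_sub_sum_integrand_mem_relations Finset.univ R r (fun _ _ => rfl)
      (fun z hz => by simpa [R] using hsum hz)
  have hdesc : ∀ i, KZ.of (R i) - KZ.of (s i) ∈ KZ.relations := fun i =>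
    singleCoordinateDescent h₁ h₂ n i a b (A i) (A' i) (R i) (s i) hab hdom (hA i) (hAc i) (hder i)
      (fun _ _ => rfl) (hsd i) (hsi i)
  have heq : KZ.of r - ∑ i, KZ.of (s i) =
      (KZ.of r - ∑ i, KZ.of (R i)) + ∑ i, (KZ.of (R i) - KZ.of (s i)) := by
    rw [Finset.sum_sub_distrib]
    abel
  rw [heq]
  exact KZ.relations.add_mem hsplit (sum_mem fun i _ => hdesc i)

/-- The crux from the registered stubs (uses the two `sorry`s above through the assembly; kept as
a type-level check that the stub signatures are exactly the assembly's hypotheses). -/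
theorem ExactDescentBox_of_stubs :
    Summit.KontsevichZagierPeriods.KontsevichZagierPeriods.Theses.GenericPointClass.ExactDescentBox :=
  ExactDescentBox_of stub_boxRelabel stub_boxLastNewtonLeibniz

end Summit.KontsevichZagierPeriods.KontsevichZagierPeriods.Cruxes.ExactDescentBox.RelabelNL
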